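import Literature.Algebra.Homology.TateCohomologyGroupIso
import Literature.Algebra.Homology.TateCohomologyConnectingNegOne
import Literature.Algebra.Homology.TateCohomologyNegTwoClasses
import HarnessLib

/-!
# `Ĥⁿ(H, f^*A) ≅ Ĥⁿ(G, A)` along a group isomorphism, on explicit classes in degrees `0`, `-1`,
# `-2`: `[x] ↦ [x]`, `[x] ↦ [x]`, `[z] ↦ [f⁻¹ ∘ z]` (Serre, *Local Fields* VII §5 — transport of
# structure; VIII §1) — on Mathlib's `tateCohomology`

Topic `Algebra/Homology`; namespace `Literature.Algebra.Homology.Tate`.  Imports the lane files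
`TateCohomologyGroupIso` (seat p30: `TateGroupIso.tateCohomologyResIso f A n : Ĥⁿ(H, f^*A) ≅ Ĥⁿ(G, A)`
for `f : H ≃* G`, built from the explicit comparison of Tate complexes `tateComplexMap` — cochains
precomposed with `f`, chains pushed forward along `f⁻¹`), `TateCohomologyConnectingNegOne`
(`zeroClass`, `negOneClass`) and `TateCohomologyNegTwoClasses` (`negTwoClass`); theorems only; NO
named fact, no `sorry`.  Lane `lit-hodgefound` (Track 2 foundations library), seat p30 gen 19, row
g19-#9 of `run/shared/lean/pub/lit-hodgefound/SKELETON.md` (plumbing for the explicit reciprocity /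
Nakayama map, where `Ĥⁿ(G, M)` is reached from `Ĥⁿ(⊤, Res_⊤ M)` through this isomorphism).

Source followed.  J.-P. Serre, *Local Fields*, GTM 67 (1979), VII §5 [held copy
`book:serre1979-local-fields`]: compatible pairs `(f, φ)` act on (co)homology ("if `f : G' → G`
and … these maps commute with the coboundary"); for an isomorphism `f : H ≅ G` and `φ = id` this is
transport of structure, the identity on the coefficient module: on `Ĥ⁰ = A^G/NA` and
`Ĥ⁻¹ = _N A/IA` (VIII §1) it is `[x] ↦ [x]`, on `Ĥ⁻² = H₁` it maps the class of a `1`-cycle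
`z = Σ m_g·(g)` of `G` to the class of `f⁻¹_* z = Σ m_g·(f⁻¹ g)`.  The tree's
`tateCohomologyResIso f A n` is `(H_n(tateComplexMap f A))⁻¹` with `tateComplexMap` Mathlib's
`cochainsMap f (𝟙)` / `chainsMap f⁻¹ (resTwist)` glued across the norm; this file evaluates its
inverse (the explicit direction) and hence the isomorphism itself on the explicit classes.

## What is formalised (`k` a commutative ring, `f : H ≃* G` finite groups, `A : Rep k G`)

* degree `0`: **`tateCohomologyResIso_inv_zeroClass`** (`[x] ↦ [x]`, `x ∈ A^G = (f^*A)^H`),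
  `tateCohomologyResIso_hom_zeroClass`;
* degree `-1`: `tateCohomologyResIso_inv_negOneClass`, `tateCohomologyResIso_hom_negOneClass`
  (`[x] ↦ [x]`, `x ∈ _N A`);
* degree `-2`: **`tateCohomologyResIso_inv_negTwoClass`** (`[z] ↦ [f⁻¹_* z]`, Mathlib's
  `mapCycles₁ f⁻¹`), `coe_mapCycles₁_resTwist` (`f⁻¹_* z = mapDomain f⁻¹ z`),
  `tateCohomologyResIso_hom_negTwoClass_mapCycles₁`.

## References
* J.-P. Serre, *Local Fields*, GTM 67, Springer (1979), VII §5; VIII §1. [Serre1979]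
* K. S. Brown, *Cohomology of Groups*, GTM 87, Springer (1982), III §8 (functoriality), VI §4.
  [Brown1982CohomologyGroups]
-/

noncomputable section

open CategoryTheory CategoryTheory.Limits groupCohomology groupHomology Finsupp

universe u

namespace Literature.Algebra.Homology

namespace Tate

variable {k G H : Type u} [CommRing k] [Group G] [Group H] [Fintype G] [Fintype H]
  (f : H ≃* G) (A : Rep.{u} k G)

/-! ## Invariants, norm kernels and `1`-cycles of `f^*A` -/

/-- `A^G ⊆ (f^*A)^H` (same elements). [cite: Serre1979, VII §5] -/
abbrev invariantsRes (x : A.ρ.invariants) : (Rep.res f.toMonoidHom A).ρ.invariants :=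
  ⟨x, fun h => x.2 (f h)⟩

/-- `(f^*A)^H ⊆ A^G` (same elements). [cite: Serre1979, VII §5] -/
abbrev invariantsOfRes (x : (Rep.res f.toMonoidHom A).ρ.invariants) : A.ρ.invariants :=
  ⟨x, fun g => by simpa using x.2 (f.symm g)⟩

omit [Fintype G] [Fintype H] in
/-- Round trip. [cite: Serre1979, VII §5] -/
@[simp]
theorem invariantsRes_invariantsOfRes (x : (Rep.res f.toMonoidHom A).ρ.invariants) :
    invariantsRes f A (invariantsOfRes f A x) = x := rfl

/-- The norms of `A` and `f^*A` agree, so `_N A = _N(f^*A)`. [cite: Serre1979, VII §5] -/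
theorem res_norm_apply (y : A.V) : (Rep.res f.toMonoidHom A).ρ.norm y = A.ρ.norm y := by
  change Representation.norm (A.ρ.comp (f : H →* G)) y = A.ρ.norm y
  rw [TateGroupIso.norm_res_eq]

/-- `_N A ⊆ _N (f^*A)` (same elements). [cite: Serre1979, VII §5] -/
abbrev kerNormRes (y : LinearMap.ker A.ρ.norm) : LinearMap.ker (Rep.res f.toMonoidHom A).ρ.norm :=
  ⟨y, by rw [LinearMap.mem_ker, res_norm_apply]; exact LinearMap.mem_ker.1 y.2⟩

/-- `_N (f^*A) ⊆ _N A` (same elements). [cite: Serre1979, VII §5] -/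
abbrev kerNormOfRes (y : LinearMap.ker (Rep.res f.toMonoidHom A).ρ.norm) : LinearMap.ker A.ρ.norm :=
  ⟨y, by rw [LinearMap.mem_ker, ← res_norm_apply f A]; exact LinearMap.mem_ker.1 y.2⟩

/-- Round trip. [cite: Serre1979, VII §5] -/
@[simp]
theorem kerNormRes_kerNormOfRes (y : LinearMap.ker (Rep.res f.toMonoidHom A).ρ.norm) :
    kerNormRes f A (kerNormOfRes f A y) = y := rfl

omit [Fintype G] [Fintype H] in
/-- The `1`-cycle `f⁻¹_* z` of `f^*A` (Mathlib's `mapCycles₁ f⁻¹ (resTwist f A)`) is `mapDomain f⁻¹ z`.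
[cite: Serre1979, VII §5] -/
theorem coe_mapCycles₁_resTwist (z : cycles₁ A) :
    ((mapCycles₁ f.symm.toMonoidHom (TateGroupIso.resTwist f A) z :
        cycles₁ (Rep.res f.toMonoidHom A)) : H →₀ A.V) = mapDomain f.symm (z : G →₀ A.V) := by
  rw [coe_mapCycles₁]
  change mapRange.linearMap (TateGroupIso.resTwist f A).hom.toLinearMap
    (lmapDomain A.V k f.symm.toMonoidHom (z : G →₀ A.V)) = _
  rw [lmapDomain_apply]
  ext h
  rw [mapRange.linearMap_apply, mapRange_apply]
  rfl

/-! ## Degree `0` -/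

/-- **`Ĥ⁰(H, f^*A) ≅ Ĥ⁰(G, A)`: its inverse (the explicit comparison map) sends `[x] ↦ [x]`.**
[cite: Serre1979, VII §5; VIII §1] -/
theorem tateCohomologyResIso_inv_zeroClass (x : A.ρ.invariants) :
    (TateGroupIso.tateCohomologyResIso f A 0).inv (zeroClass A x) =
      zeroClass (Rep.res f.toMonoidHom A) (invariantsRes f A x) := by
  change HomologicalComplex.homologyMap (TateGroupIso.tateComplexMap f A) 0
      ((tateComplex A).homologyπ 0 (invariantsToCycles A x)) =
    (tateComplex (Rep.res f.toMonoidHom A)).homologyπ 0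
      (invariantsToCycles (Rep.res f.toMonoidHom A) (invariantsRes f A x))
  rw [← ModuleCat.comp_apply ((tateComplex A).homologyπ 0), HomologicalComplex.homologyπ_naturality,
    ModuleCat.comp_apply]
  congr 1
  apply (ModuleCat.mono_iff_injective ((tateComplex (Rep.res f.toMonoidHom A)).iCycles 0)).1
    inferInstance
  rw [← ModuleCat.comp_apply _ ((tateComplex (Rep.res f.toMonoidHom A)).iCycles 0),
    HomologicalComplex.cyclesMap_i, ModuleCat.comp_apply]
  apply (ModuleCat.mono_iff_injective (cochainsIso₀ (Rep.res f.toMonoidHom A)).hom).1 inferInstance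
  rw [cochainsIso₀_hom_iCycles_invariantsToCycles]
  change (cochainsIso₀ (Rep.res f.toMonoidHom A)).hom
      ((cochainsMap f.toMonoidHom (𝟙 (Rep.res f.toMonoidHom A))).f 0
        ((tateComplex A).iCycles 0 (invariantsToCycles A x))) = (x : A.V)
  rw [← ModuleCat.comp_apply, cochainsMap_f_0_comp_cochainsIso₀, ModuleCat.comp_apply,
    cochainsIso₀_hom_iCycles_invariantsToCycles]
  rfl

/-- **`Ĥ⁰(H, f^*A) ≅ Ĥ⁰(G, A)` sends `[x] ↦ [x]`.** [cite: Serre1979, VII §5; VIII §1] -/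
theorem tateCohomologyResIso_hom_zeroClass (x : (Rep.res f.toMonoidHom A).ρ.invariants) :
    (TateGroupIso.tateCohomologyResIso f A 0).hom (zeroClass (Rep.res f.toMonoidHom A) x) =
      zeroClass A (invariantsOfRes f A x) := by
  rw [← invariantsRes_invariantsOfRes f A x, ← tateCohomologyResIso_inv_zeroClass,
    Iso.inv_hom_id_apply]

/-! ## Degree `-1` -/

/-- **`Ĥ⁻¹(H, f^*A) ≅ Ĥ⁻¹(G, A)`: its inverse sends `[x] ↦ [x]`** (`x ∈ _N A`).
[cite: Serre1979, VII §5; VIII §1] -/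
theorem tateCohomologyResIso_inv_negOneClass (y : LinearMap.ker A.ρ.norm) :
    (TateGroupIso.tateCohomologyResIso f A (-1)).inv (negOneClass A y) =
      negOneClass (Rep.res f.toMonoidHom A) (kerNormRes f A y) := by
  change HomologicalComplex.homologyMap (TateGroupIso.tateComplexMap f A) (-1)
      ((tateComplex A).homologyπ (-1) (kerNormToCycles A y)) =
    (tateComplex (Rep.res f.toMonoidHom A)).homologyπ (-1)
      (kerNormToCycles (Rep.res f.toMonoidHom A) (kerNormRes f A y))
  rw [← ModuleCat.comp_apply ((tateComplex A).homologyπ (-1)),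
    HomologicalComplex.homologyπ_naturality, ModuleCat.comp_apply]
  congr 1
  apply (ModuleCat.mono_iff_injective ((tateComplex (Rep.res f.toMonoidHom A)).iCycles (-1))).1
    inferInstance
  rw [← ModuleCat.comp_apply _ ((tateComplex (Rep.res f.toMonoidHom A)).iCycles (-1)),
    HomologicalComplex.cyclesMap_i, ModuleCat.comp_apply]
  change (chainsMap f.symm.toMonoidHom (TateGroupIso.resTwist f A)).f 0
      ((tateComplex A).iCycles (-1) (kerNormToCycles A y)) =
    (tateComplex (Rep.res f.toMonoidHom A)).iCycles (-1)
      (kerNormToCycles (Rep.res f.toMonoidHom A) (kerNormRes f A y))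
  apply (ModuleCat.mono_iff_injective (chainsIso₀ (Rep.res f.toMonoidHom A)).hom).1 inferInstance
  rw [← ModuleCat.comp_apply, chainsMap_f_0_comp_chainsIso₀, ModuleCat.comp_apply,
    chainsIso₀_hom_iCycles_kerNormToCycles, chainsIso₀_hom_iCycles_kerNormToCycles]
  rfl

/-- **`Ĥ⁻¹(H, f^*A) ≅ Ĥ⁻¹(G, A)` sends `[x] ↦ [x]`.** [cite: Serre1979, VII §5; VIII §1] -/
theorem tateCohomologyResIso_hom_negOneClass (y : LinearMap.ker (Rep.res f.toMonoidHom A).ρ.norm) :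
    (TateGroupIso.tateCohomologyResIso f A (-1)).hom (negOneClass (Rep.res f.toMonoidHom A) y) =
      negOneClass A (kerNormOfRes f A y) := by
  rw [← kerNormRes_kerNormOfRes f A y, ← tateCohomologyResIso_inv_negOneClass,
    Iso.inv_hom_id_apply]

/-! ## Degree `-2` -/

/-- **`Ĥ⁻²(H, f^*A) ≅ Ĥ⁻²(G, A)`: its inverse sends the class of a `1`-cycle `z` to the class of
`f⁻¹_* z = mapDomain f⁻¹ z`.** [cite: Serre1979, VII §5; VIII §1] -/
theorem tateCohomologyResIso_inv_negTwoClass (z : cycles₁ A) :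
    (TateGroupIso.tateCohomologyResIso f A (-2)).inv (negTwoClass A z) =
      negTwoClass (Rep.res f.toMonoidHom A)
        (mapCycles₁ f.symm.toMonoidHom (TateGroupIso.resTwist f A) z) := by
  change HomologicalComplex.homologyMap (TateGroupIso.tateComplexMap f A) (-2)
      ((tateComplex A).homologyπ (-2) (cycles₁ToCycles A z)) =
    (tateComplex (Rep.res f.toMonoidHom A)).homologyπ (-2)
      (cycles₁ToCycles (Rep.res f.toMonoidHom A)
        (mapCycles₁ f.symm.toMonoidHom (TateGroupIso.resTwist f A) z))
  rw [← ModuleCat.comp_apply ((tateComplex A).homologyπ (-2)),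
    HomologicalComplex.homologyπ_naturality, ModuleCat.comp_apply]
  congr 1
  apply (ModuleCat.mono_iff_injective ((tateComplex (Rep.res f.toMonoidHom A)).iCycles (-2))).1
    inferInstance
  rw [← ModuleCat.comp_apply _ ((tateComplex (Rep.res f.toMonoidHom A)).iCycles (-2)),
    HomologicalComplex.cyclesMap_i, ModuleCat.comp_apply, iCycles_cycles₁ToCycles,
    iCycles_cycles₁ToCycles]
  change (chainsMap f.symm.toMonoidHom (TateGroupIso.resTwist f A)).f 1
      ((chainsIso₁ A).inv (z : G →₀ A.V)) =
    (chainsIso₁ (Rep.res f.toMonoidHom A)).inv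
      (chainsMap₁ f.symm.toMonoidHom (TateGroupIso.resTwist f A) (z : G →₀ A.V))
  apply (ModuleCat.mono_iff_injective (chainsIso₁ (Rep.res f.toMonoidHom A)).hom).1 inferInstance
  rw [← ModuleCat.comp_apply, chainsMap_f_1_comp_chainsIso₁, ModuleCat.comp_apply,
    ← ModuleCat.comp_apply (chainsIso₁ A).inv, Iso.inv_hom_id, ModuleCat.id_apply,
    ← ModuleCat.comp_apply, Iso.inv_hom_id, ModuleCat.id_apply]

/-- **`Ĥ⁻²(H, f^*A) ≅ Ĥ⁻²(G, A)` sends `[f⁻¹_* z] ↦ [z]`.** [cite: Serre1979, VII §5; VIII §1] -/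
theorem tateCohomologyResIso_hom_negTwoClass_mapCycles₁ (z : cycles₁ A) :
    (TateGroupIso.tateCohomologyResIso f A (-2)).hom
        (negTwoClass (Rep.res f.toMonoidHom A)
          (mapCycles₁ f.symm.toMonoidHom (TateGroupIso.resTwist f A) z)) =
      negTwoClass A z := by
  rw [← tateCohomologyResIso_inv_negTwoClass, Iso.inv_hom_id_apply]

end Tate

end Literature.Algebra.Homology
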